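import Summits.KontsevichZagierPeriods.Zeta5Search.DualSeriesSharpDenominators
import Literature.NumberTheory.Transcendental.ZudilinLemma19
import HarnessLib

/-!
# ζ(5) search — the `p`-ADIC ORDER of the coefficients of `F̃₇(b)`: Zudilin's (8.11) for the dual series (cell `pub-zeta5`, fam-denom 62)

HONEST FRAMING: systematic search; no irrationality claim unless certified.

OUR theorem (Summit side), generic in the dual parameters `b`.  `DualSeriesSharpDenominators` proved the INTEGRALITY
half of Zudilin 2004, Lemma 19 for `F̃₇(b)` (Brown–Zudilin arXiv:2210.03391, (34)–(35)): with the pair grouping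
`(1,6),(7,1),(2,7),(6,4),(4,5),(5,3)` of (35), the regularised product `G_i = (t+i+1)⁶·N♯(b)·R_b(t)`
(`DualSeriesDenominators.Gfun b i`) has `D^j (1/j!) G_i^{(j)}(−i−1) ∈ ℤ`, whence `d^{5−o}·N♯(b)·c_{o,i} ∈ ℤ`.
This file proves the ORDER half — Zudilin's (8.11) [Zudilin 2004 = arXiv:math/0206176, §7 Lemmas 17–18, §8 (8.7)–(8.11)]
transported to the cell's pair grouping: for every prime `p` with `p > 5` and `p² > b₀`,

* `Gfun_isDOrd` — `ord_p G_i^{(j)}(−i−1) ≥ −j + ν(b; i, p)` for all `j`, where (`nuPair`, integer divisions)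

    `ν(b;i,p) = [i/p] − [(i−b₃)/p] − [b₃/p] + [(b₀−i)/p] − [(b₀−b₂−i)/p] − [b₂/p]`
    `         + Σ_{pairs (j,k)} ( [(b₀−b_j−b_k)/p] − [(i−b_j)/p] − [(b₀−b_k−i)/p] )`

  is the sum of the brick exponents of Lemma 17 (`polyBrick_isDOrd`, the two polynomial bricks `f₃/b₃!`, `s₂/b₂!`)
  and Lemma 18 (`recipBrickReg_isDOrd`, the six reciprocal bricks), assembled by the Leibniz rule (`IsDOrd.mul/prod`);
  each bracket is `⌊x+y⌋ − ⌊x⌋ − ⌊y⌋ ∈ {0, 1}`;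
* `padicOrdGe_sharp_pfData` — **`ord_p (N♯(b)·c_{o,i}) ≥ ν(b;i,p) − (5−o)`** for THE canonical partial-fraction data
  (`WedgeDictionary.pfData`), through the bridge `divDeriv_eq_coeff`;
* `padicOrdGe_sharp_coeffU/W/V` — `ord_p (N♯U) ≥ ν − 1`, `ord_p (N♯W) ≥ ν − 3`, `ord_p (N♯V) ≥ ν − 6` for any
  `ν ≤ min_{i ≤ b₀} ν(b;i,p)` and
* `padicOrdGe_sharp_ints` — for `p ≤ b₀ < p²`: **`p^ν` divides the three integers `d·N♯U`, `d³·N♯W`, `d⁶·N♯V`**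
  (`d = d_{b₀}`), the form consumed by the record-ray kernel (`Certificates/RecordRayDenominators*`).

This is the generic-`b` p-adic input of the "Φ/(8.11) port" (census g27 KERNEL-LEDGER: brick deficit 61.5 nats/step on the
record ray).  `p`-adic valuations of rational numbers only; nothing here bears on irrationality.  0 sorry.
-/

noncomputable section

open Finset Filter Topology
open Literature.NumberTheory.Transcendental
open Literature.NumberTheory.Transcendental.BallRivoal

namespace Summit.KontsevichZagierPeriods.Zeta5Search

namespace Denom.DualSeriesBrickOrd

open DualSeries WedgeDictionary DualSeriesDenominators

/-! ### The brick exponent `ν(b; i, p)` -/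

/-- **`ν(b; i, p)`** — the sum of the `p`-adic brick exponents of `G_i` at its pole `−(i+1)` (Zudilin's `ν_{k,p}` of
(8.9) for the pair grouping of Brown–Zudilin (35); integer divisions = floors). -/
def nuPair (b : ℕ → ℤ) (i p : ℕ) : ℤ :=
  ((i : ℤ) / p - ((i : ℤ) - bn b 3) / p - (bn b 3 : ℤ) / p)
  + (((bn b 0 : ℤ) - i) / p - ((bn b 0 : ℤ) - bn b 2 - i) / p - (bn b 2 : ℤ) / p)
  + ∑ s ∈ range 6, (((bn b 0 : ℤ) - bn b (pfst s) - bn b (psnd s)) / p - ((i : ℤ) - bn b (pfst s)) / p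
      - ((bn b 0 : ℤ) - bn b (psnd s) - i) / p)

/-! ### (8.11) for the regularised product -/

/-- **`ord_p G_i^{(j)}(−i−1) ≥ −j + ν(b;i,p)`** for every prime `p` with `p² > b₀`, every `i ≤ b₀` and all `j ≤ N`
(Lemma 17 for the two polynomial bricks, Lemma 18 for the six regularised reciprocal bricks on the block `[1, b₀+2)`,
the linear factor has integer derivatives; Leibniz). -/
theorem Gfun_isDOrd {b : ℕ → ℤ} (hP : ∀ s, s < 6 → bn b (pfst s) + bn b (psnd s) ≤ bn b 0)
    {p : ℕ} [hp : Fact p.Prime] (hp2 : bn b 0 < p ^ 2) {i : ℕ} (hi : i ≤ bn b 0) (N : ℕ) :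
    IsDOrd p (nuPair b i p) N (Gfun b i) (-(((i : ℤ) + 1 : ℤ) : ℚ)) := by
  have hp0 : (0 : ℤ) < p := by exact_mod_cast hp.out.pos
  have h3 : bn b 3 ≤ bn b 0 := by have := hP 5 (by norm_num); simp only [pfst, psnd] at this; omega
  have h2 : bn b 2 ≤ bn b 0 := by have := hP 2 (by norm_num); simp only [pfst, psnd] at this; omega
  -- the linear factor: integer derivatives
  have hlin : IsDOrd p 0 N (fun t : ℚ => 2 * t + ((bn b 0 : ℚ) + 2)) (-(((i : ℤ) + 1 : ℤ) : ℚ)) := by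
    refine IsDOrd.of_int_derivs ((contDiffAt_const.mul contDiffAt_id).add contDiffAt_const) fun j _ => ?_
    rw [iteratedDeriv_affine]
    rcases j with _ | _ | j
    · exact ⟨2 * (-((i : ℤ) + 1)) + (bn b 0 + 2), by push_cast; simp⟩
    · exact ⟨2, by simp⟩
    · exact ⟨0, by simp⟩
  -- the polynomial brick `f₃/b₃! = polyBrick 1 b₃` (Lemma 17, `b₃ < p²`)
  have hP1 : IsDOrd p ((i : ℤ) / p - ((i : ℤ) - bn b 3) / p - (bn b 3 : ℤ) / p) N (polyBrick 1 (bn b 3))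
      (-(((i : ℤ) + 1 : ℤ) : ℚ)) := by
    refine (polyBrick_isDOrd p 1 (bn b 3) (by omega) ((i : ℤ) + 1) N).mono (le_of_eq ?_)
    have e1 : ((1 : ℤ) + (bn b 3 : ℕ) - 1 - ((i : ℤ) + 1)) / (p : ℤ) = -(((i : ℤ) - bn b 3) / p) - 1 := by
      rw [show ((1 : ℤ) + (bn b 3 : ℕ) - 1 - ((i : ℤ) + 1)) = -((i : ℤ) - bn b 3) - 1 by ring]
      exact Int.neg_sub_one_ediv_eq _ hp0
    have e2 : ((1 : ℤ) - 1 - ((i : ℤ) + 1)) / (p : ℤ) = -((i : ℤ) / p) - 1 := by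
      rw [show ((1 : ℤ) - 1 - ((i : ℤ) + 1)) = -(i : ℤ) - 1 by ring]
      exact Int.neg_sub_one_ediv_eq _ hp0
    rw [e1, e2]
    ring
  -- the polynomial brick `s₂/b₂! = polyBrick (b₀−b₂+2) b₂` (Lemma 17, `b₂ < p²`)
  have hP2 : IsDOrd p (((bn b 0 : ℤ) - i) / p - ((bn b 0 : ℤ) - bn b 2 - i) / p - (bn b 2 : ℤ) / p) N
      (polyBrick ((bn b 0 : ℤ) - bn b 2 + 2) (bn b 2)) (-(((i : ℤ) + 1 : ℤ) : ℚ)) := by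
    refine (polyBrick_isDOrd p ((bn b 0 : ℤ) - bn b 2 + 2) (bn b 2) (by omega) ((i : ℤ) + 1) N).mono (le_of_eq ?_)
    have e1 : ((bn b 0 : ℤ) - bn b 2 + 2 + (bn b 2 : ℕ) - 1 - ((i : ℤ) + 1)) = (bn b 0 : ℤ) - i := by ring
    have e2 : ((bn b 0 : ℤ) - bn b 2 + 2 - 1 - ((i : ℤ) + 1)) = (bn b 0 : ℤ) - bn b 2 - i := by ring
    rw [e1, e2]
  -- the six regularised reciprocal bricks (Lemma 18, `a₀ = 1`, `b₀' = b₀ + 2`, `b₀ < p²`)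
  have hrec : ∀ s ∈ range 6, IsDOrd p
      (((bn b 0 : ℤ) - bn b (pfst s) - bn b (psnd s)) / p - ((i : ℤ) - bn b (pfst s)) / p
        - ((bn b 0 : ℤ) - bn b (psnd s) - i) / p) N
      (recipBrickReg ((bn b (pfst s) : ℤ) + 1) (blockLen b s) ((i : ℤ) + 1)) (-(((i : ℤ) + 1 : ℤ) : ℚ)) := by
    intro s hs
    have hle := hP s (mem_range.1 hs)
    refine (recipBrickReg_isDOrd p (a₀ := 1) (b₀ := (bn b 0 : ℤ) + 2) (a := (bn b (pfst s) : ℤ) + 1)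
      (m := blockLen b s) (k := (i : ℤ) + 1) (by unfold blockLen; omega) (by omega)
      (by unfold blockLen; omega) (by omega) (by omega) (by nlinarith) N).mono (le_of_eq ?_)
    have c1 : ((blockLen b s : ℕ) : ℤ) - 1 = (bn b 0 : ℤ) - bn b (pfst s) - bn b (psnd s) := by
      unfold blockLen; omega
    have c2 : (i : ℤ) + 1 - ((bn b (pfst s) : ℤ) + 1) = (i : ℤ) - bn b (pfst s) := by ring
    have c3 : (bn b (pfst s) : ℤ) + 1 + (blockLen b s : ℕ) - 1 - ((i : ℤ) + 1) = (bn b 0 : ℤ) - bn b (psnd s) - i := by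
      unfold blockLen; omega
    rw [c1, c2, c3]
  have hall := ((hlin.mul hP1).mul hP2).mul (IsDOrd.prod (range 6) hrec)
  unfold Gfun
  refine hall.mono (le_of_eq ?_)
  unfold nuPair
  ring

/-! ### (8.11) for the coefficients -/

/-- **`ord_p (N♯(b)·c_{o,i}) ≥ ν(b;i,p) − (5−o)`** for the canonical partial-fraction data of `R_b`, every prime
`p > 5` with `p² > b₀`, `o < 6`, `i ≤ b₀` (the bridge `divDeriv_eq_coeff`: `N♯·c_{o,i} = (1/(5−o)!) G_i^{(5−o)}(−i−1)`). -/
theorem padicOrdGe_sharp_pfData {b : ℕ → ℤ} (hb : InBox b)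
    (hP : ∀ s, s < 6 → bn b (pfst s) + bn b (psnd s) ≤ bn b 0)
    (hsum : ∑ j ∈ range 7, b (j + 1) ≤ 3 * b 0 + 1)
    {p : ℕ} [hp : Fact p.Prime] (hp5 : 5 < p) (hp2 : bn b 0 < p ^ 2) {o i : ℕ} (ho : o < 6) (hi : i ≤ bn b 0) :
    PadicOrdGe p (nuPair b i p - ((5 - o : ℕ) : ℤ)) (sharpNormaliser b * pfData b o i) := by
  obtain ⟨c, hc⟩ := exists_isPFData b hb hsum
  have hd : IsPFData b (pfData b) := isPFData_pfData hc
  have hG := Gfun_isDOrd hP hp2 hi 5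
  have hx : (-(((i : ℤ) + 1 : ℤ) : ℚ)) = -(i : ℚ) - 1 := by push_cast; ring
  rw [hx] at hG
  have hcoef := divDeriv_eq_coeff (bn b 0) 6 (fun o q => sharpNormaliser b * pfData b o q) (Gfun b i) hi
    hG.contDiffAt.continuousAt ?_ (a := 5 - o) (by omega)
  · have hord := hG.padicOrdGe_divDeriv hp5 (j := 5 - o) (by omega)
    rw [hcoef, show 6 - 1 - (5 - o) = o by omega] at hord
    exact hord
  · -- `Gfun = pfEval · (t+i+1)^6` on a punctured neighbourhood (as in `exists_int_data_sharp`)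
    have h := eventually_ne_poles (1 : ℤ) (bn b 0 + 1) ((i : ℤ) + 1)
    rw [show (-(((i : ℤ) + 1 : ℤ) : ℚ)) = -(i : ℚ) - 1 by push_cast; ring] at h
    filter_upwards [h] with t ht
    have htp : t + i + 1 ≠ 0 := by
      have := ht.1; push_cast at this; intro h0; exact this (by linarith)
    have htq : ∀ q, q ≤ bn b 0 → t + q + 1 ≠ 0 := by
      intro q hq h0
      have := ht.2 q (mem_range.2 (by omega)); push_cast at this; exact this (by linarith)
    exact Gfun_eq hb hP hd i t htp htq

/-- **`ord_p (N♯(b)·U(b)) ≥ ν − 1`** for any `ν ≤ min_{i ≤ b₀} ν(b;i,p)`. -/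
theorem padicOrdGe_sharp_coeffU {b : ℕ → ℤ} (hb : InBox b)
    (hP : ∀ s, s < 6 → bn b (pfst s) + bn b (psnd s) ≤ bn b 0)
    (hsum : ∑ j ∈ range 7, b (j + 1) ≤ 3 * b 0 + 1)
    {p : ℕ} [hp : Fact p.Prime] (hp5 : 5 < p) (hp2 : bn b 0 < p ^ 2)
    {ν : ℤ} (hν : ∀ i, i ≤ bn b 0 → ν ≤ nuPair b i p) :
    PadicOrdGe p (ν - 1) (sharpNormaliser b * coeffU b) := by
  rw [coeffU, show (b 0).toNat = bn b 0 by rfl, mul_sum]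
  refine PadicOrdGe.sum fun i hi => ?_
  have hi' := Nat.lt_succ_iff.1 (mem_range.1 hi)
  have h := padicOrdGe_sharp_pfData hb hP hsum hp5 hp2 (o := 4) (by norm_num) hi'
  exact h.mono (by have := hν i hi'; omega)

/-- **`ord_p (N♯(b)·W(b)) ≥ ν − 3`** for any `ν ≤ min_{i ≤ b₀} ν(b;i,p)`. -/
theorem padicOrdGe_sharp_coeffW {b : ℕ → ℤ} (hb : InBox b)
    (hP : ∀ s, s < 6 → bn b (pfst s) + bn b (psnd s) ≤ bn b 0)
    (hsum : ∑ j ∈ range 7, b (j + 1) ≤ 3 * b 0 + 1)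
    {p : ℕ} [hp : Fact p.Prime] (hp5 : 5 < p) (hp2 : bn b 0 < p ^ 2)
    {ν : ℤ} (hν : ∀ i, i ≤ bn b 0 → ν ≤ nuPair b i p) :
    PadicOrdGe p (ν - 3) (sharpNormaliser b * coeffW b) := by
  rw [coeffW, show (b 0).toNat = bn b 0 by rfl, mul_sum]
  refine PadicOrdGe.sum fun i hi => ?_
  have hi' := Nat.lt_succ_iff.1 (mem_range.1 hi)
  have h := padicOrdGe_sharp_pfData hb hP hsum hp5 hp2 (o := 2) (by norm_num) hi'
  exact h.mono (by have := hν i hi'; omega)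

/-- `ord_p H_i^{(m)} ≥ −m·ord_p d_n` for `i ≤ n` (`d_n^m · H_i^{(m)} ∈ ℤ`, `BallRivoal.isInt_dpow_mul_harm`). -/
theorem padicOrdGe_harm {p : ℕ} [hp : Fact p.Prime] {n : ℕ} (m i : ℕ) (hi : i ≤ n) :
    PadicOrdGe p (-((m : ℤ) * padicValNat p (Nat.lcmUpto n))) (harm m i) := by
  obtain ⟨z, hz⟩ := isInt_dpow_mul_harm n (Nat.lcmUpto n) (fun k h1 h2 => natCast_dvd_lcmUpto h1 h2) m i hi
  have hd : ((Nat.lcmUpto n : ℕ) : ℚ) ≠ 0 := by exact_mod_cast (Nat.lcmUpto_pos n).ne'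
  have hh : harm m i = (z : ℚ) * ((((Nat.lcmUpto n : ℕ) : ℚ) ^ m))⁻¹ := by
    rw [← hz, mul_comm ((((Nat.lcmUpto n : ℕ) : ℚ)) ^ m) _, mul_assoc, mul_inv_cancel₀ (pow_ne_zero _ hd),
      mul_one]
  rw [hh]
  have h1 : PadicOrdGe p 0 (z : ℚ) := PadicOrdGe.of_int z
  have h2 : PadicOrdGe p (-((m : ℤ) * padicValNat p (Nat.lcmUpto n))) ((((Nat.lcmUpto n : ℕ) : ℚ) ^ m))⁻¹ := by
    refine Or.inr (le_of_eq ?_)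
    rw [padicValRat.inv, padicValRat.pow, padicValRat.of_nat]
  simpa using h1.mul h2

/-- **`ord_p (N♯(b)·V(b)) ≥ ν − 6`** for any `ν ≤ min_{i ≤ b₀} ν(b;i,p)` (`b₀ < p²`, so `ord_p d_{b₀} ≤ 1`):
`V = Σ c_{o,i} H_i^{(o+1)}` and `ord_p H_i^{(o+1)} ≥ −(o+1)·ord_p d_{b₀}`. -/
theorem padicOrdGe_sharp_coeffV {b : ℕ → ℤ} (hb : InBox b)
    (hP : ∀ s, s < 6 → bn b (pfst s) + bn b (psnd s) ≤ bn b 0)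
    (hsum : ∑ j ∈ range 7, b (j + 1) ≤ 3 * b 0 + 1)
    {p : ℕ} [hp : Fact p.Prime] (hp5 : 5 < p) (hp2 : bn b 0 < p ^ 2)
    {ν : ℤ} (hν : ∀ i, i ≤ bn b 0 → ν ≤ nuPair b i p) :
    PadicOrdGe p (ν - 6) (sharpNormaliser b * coeffV b) := by
  have hD : padicValNat p (Nat.lcmUpto (bn b 0)) ≤ 1 := Zudilin2004.padicValNat_lcmUpto_le_one hp2
  rw [coeffV, show (b 0).toNat = bn b 0 by rfl, mul_sum]
  refine PadicOrdGe.sum fun o ho => ?_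
  rw [mul_sum]
  refine PadicOrdGe.sum fun i hi => ?_
  have ho' := mem_range.1 ho
  have hi' := Nat.lt_succ_iff.1 (mem_range.1 hi)
  have h1 := padicOrdGe_sharp_pfData hb hP hsum hp5 hp2 ho' hi'
  have h2 := padicOrdGe_harm (p := p) (n := bn b 0) (o + 1) i hi'
  have h12 := h1.mul h2
  rw [← mul_assoc]
  refine h12.mono ?_
  have hνi := hν i hi'
  have hD0 : (0 : ℤ) ≤ padicValNat p (Nat.lcmUpto (bn b 0)) := by exact_mod_cast Nat.zero_le _
  have hD1 : (padicValNat p (Nat.lcmUpto (bn b 0)) : ℤ) ≤ 1 := by exact_mod_cast hD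
  have hm : ((o + 1 : ℕ) : ℤ) * padicValNat p (Nat.lcmUpto (bn b 0)) ≤ ((o + 1 : ℕ) : ℤ) := by
    have := mul_le_of_le_one_right (show (0 : ℤ) ≤ ((o + 1 : ℕ) : ℤ) by positivity) hD1
    simpa using this
  push_cast at hm ⊢
  omega

/-! ### The integers of the kernel: `p^ν ∣ d·N♯U, d³·N♯W, d⁶·N♯V` -/

/-- **`p^ν` divides `d·N♯(b)·U(b)`, `d³·N♯(b)·W(b)` and `d⁶·N♯(b)·V(b)`** (`d = d_{b₀}`, `ord_p d = 1` for `p ≤ b₀ < p²`)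
for any `ν ≤ min_{i ≤ b₀} ν(b;i,p)` and every prime `5 < p ≤ b₀ < p²`: `ord_p` of the three products is `≥ ν`. -/
theorem padicOrdGe_sharp_ints {b : ℕ → ℤ} (hb : InBox b)
    (hP : ∀ s, s < 6 → bn b (pfst s) + bn b (psnd s) ≤ bn b 0)
    (hsum : ∑ j ∈ range 7, b (j + 1) ≤ 3 * b 0 + 1)
    {p : ℕ} [hp : Fact p.Prime] (hp5 : 5 < p) (hpb : p ≤ bn b 0) (hp2 : bn b 0 < p ^ 2)
    {ν : ℤ} (hν : ∀ i, i ≤ bn b 0 → ν ≤ nuPair b i p) :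
    PadicOrdGe p ν (((Nat.lcmUpto (bn b 0) : ℕ) : ℚ) * sharpNormaliser b * coeffU b) ∧
    PadicOrdGe p ν (((Nat.lcmUpto (bn b 0) : ℕ) : ℚ) ^ 3 * sharpNormaliser b * coeffW b) ∧
    PadicOrdGe p ν (((Nat.lcmUpto (bn b 0) : ℕ) : ℚ) ^ 6 * sharpNormaliser b * coeffV b) := by
  have hdv : padicValNat p (Nat.lcmUpto (bn b 0)) = 1 := Zudilin2004.padicValNat_lcmUpto_eq_one hpb hp2
  have hd0 : ((Nat.lcmUpto (bn b 0) : ℕ) : ℚ) ≠ 0 := by exact_mod_cast (Nat.lcmUpto_pos _).ne'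
  have hdk : ∀ k : ℕ, PadicOrdGe p (k : ℤ) (((Nat.lcmUpto (bn b 0) : ℕ) : ℚ) ^ k) := fun k => by
    refine Or.inr (le_of_eq ?_)
    rw [padicValRat.pow, padicValRat.of_nat, hdv]
    simp
  have hU := padicOrdGe_sharp_coeffU hb hP hsum hp5 hp2 hν
  have hW := padicOrdGe_sharp_coeffW hb hP hsum hp5 hp2 hν
  have hV := padicOrdGe_sharp_coeffV hb hP hsum hp5 hp2 hν
  refine ⟨?_, ?_, ?_⟩
  · have := (hdk 1).mul hU
    rw [pow_one] at this
    rw [mul_assoc]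
    exact this.mono (by push_cast; omega)
  · have := (hdk 3).mul hW
    rw [mul_assoc]
    exact this.mono (by push_cast; omega)
  · have := (hdk 6).mul hV
    rw [mul_assoc]
    exact this.mono (by push_cast; omega)

end Denom.DualSeriesBrickOrd

end Summit.KontsevichZagierPeriods.Zeta5Search
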